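import Literature.Analysis.FluidPDE.AlbrittonBarker2020LocalConcentrationBlowup
import Literature.Analysis.FluidPDE.LocalTypeIScaling
import Literature.Analysis.FluidPDE.CKNScalingExtras
import Literature.Analysis.FluidPDE.Seregin2019ScaleInvariantBounds
import Literature.Analysis.FluidPDE.Seregin2019OneScaleBoundedPressure
import Literature.Analysis.FluidPDE.ESSLocalHolderBlowupProperties
import HarnessLib

/-!
# Seregin 2019, §4: the data of ONE rescaled violator

Analysis/FluidPDE proofs-only file (theorems only: no definitions, no named facts, no `sorry`),
a tranche of the input `Literature.Analysis.FluidPDE.seregin2019_localWeakL3_epsRegularity`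
(`Seregin2019LocalWeakL3.lean`; G. Seregin, arXiv:1906.06707 = St. Petersburg Math. J. 32 (2021)
565–576, Prop. 1.3/1.4 and §4). No Navier–Stokes regularity statement is proved here.

In the proof of Prop. 1.3 by contradiction (§4) each violator `(v, q)` of the statement in
`Q(z₀, R)` is (i) bounded in the scale-invariant norms, (scale inv.) `Θ(z, r) ≤ c(M)(N+1)`
(here: the tree's `scaledEnergies_bounded_of_weakL3_slices`, after the ball-mean gauge of the
pressure which turns `D₀(R)` into `D(R)`), and (ii) rescaled, `u ↦ λ u(t₀ + λ² s, x₀ + λ y)`,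
`p ↦ λ² p(…)`. This file records, for ONE violator and ONE scale `λ`, what the rescaled pair
inherits (Albritton–Barker's class on `Q(0, R/λ)` is the tree's
`IsSuitableWeakSolutionInBall.zoom_radius`; here: the scaled energies at shifted apices, the
`L³ × L^{3/2}` levels, the weak-`L³` slice bound, the sparse top slice, the weak left-continuity
at the top time), in the shapes consumed by `Seregin2019.false_of_blowupSequence`.

## References

* G. Seregin, arXiv:1906.06707 (2019), §2 (2.1), §4 (4.5)–(4.8). [`Seregin2019`]
* L. Caffarelli, R. Kohn, L. Nirenberg, CPAM 35 (1982), §2 (scaling). [CaffarelliKohnNirenberg1982]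
-/

noncomputable section

open MeasureTheory Set Function Filter Topology TopologicalSpace Metric
open scoped NNReal ENNReal InnerProductSpace RealInnerProductSpace

namespace Literature.Analysis.FluidPDE

namespace Seregin2019

/-! ### Slices of the class `IsSuitableWeakSolutionInBall` -/

/-- The slices of a suitable weak solution in `Q(z₀,R)` are a.e.-strongly measurable on
`B(x₀,R)` for a.e. `t ∈ ]t₀-R²,t₀[` — part of the class `v ∈ L_{2,∞}(Q(z₀,R))` of Seregin's
Definition 1.1, read off by Fubini from the measurability of `u` on the parabolic ball.
[cite: Seregin2019, §1 Definition 1.1 (v ∈ L_{2,∞})] -/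
theorem ae_aestronglyMeasurable_ballSlice {R : ℝ} {z₀ : ℝ × EuclideanSpace ℝ (Fin 3)}
    {u : ℝ → EuclideanSpace ℝ (Fin 3) → EuclideanSpace ℝ (Fin 3)} {p : ℝ → EuclideanSpace ℝ (Fin 3) → ℝ}
    (hU : IsSuitableWeakSolutionInBall R z₀ u p) :
    ∀ᵐ t ∂(volume.restrict (Ioo (z₀.1 - R ^ 2) z₀.1)),
      AEStronglyMeasurable (u t) (volume.restrict (ball z₀.2 R)) := by
  have hm : AEStronglyMeasurable (uncurry u) (volume.restrict (parabolicCylinder R z₀)) :=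
    hU.1.distributional.1.aestronglyMeasurable
  have hprod : (volume.restrict (parabolicCylinder R z₀) : Measure (ℝ × EuclideanSpace ℝ (Fin 3))) =
      (volume.restrict (Ioo (z₀.1 - R ^ 2) z₀.1)).prod (volume.restrict (ball z₀.2 R)) := by
    rw [parabolicCylinder, Measure.volume_eq_prod, Measure.prod_restrict]
  rw [hprod] at hm
  filter_upwards [hm.prodMk_left] with s hs
  exact hs

/-! ### (scale inv.): the scaled energies of a violator are bounded at all good apices -/

/-- `M³ ≤ (M⁺)³` inside `ENNReal.ofReal`. [folklore] -/
private theorem ofReal_pow_three_le_toNNReal (M : ℝ) :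
    ENNReal.ofReal (M ^ 3) ≤ ENNReal.ofReal (((M.toNNReal : ℝ≥0) : ℝ) ^ 3) := by
  rcases le_or_gt 0 M with h | h
  · rw [Real.coe_toNNReal M h]
  · rw [ENNReal.ofReal_of_nonpos (Odd.pow_neg (⟨1, by norm_num⟩ : Odd 3) h).le]
    exact bot_le

/-- **Seregin 2019, (2.1)/(4.5) for a violator of Prop. 1.4** (`Θ(z,r) ≤ c(M)(N+1)`): for all
reals `M, N` there is `K` such that for every suitable weak solution `(u,p)` in `Q(z₀,R)` with a
weak gradient `G`, `D₀(R) + E(R) ≤ N` and weak-`L³` slices `α³|{x ∈ B(x₀,R) : α < |u(t,x)|}| ≤ M³`,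
at every apex `z` with `Q(z, R/2) ⊆ Q(z₀, R)` and every radius `0 < r ≤ R/4` each of
`A(z,r)`, `E(z,r)`, `C(z,r)` and the PLAIN pressure quantity `D(z,r)` of the ball-mean–gauged
pressure `p − [p]_{B(x₀,R)}` is `≤ K` (gauge: `isSuitableWeakSolutionInBall_sub_ballMean`,
`cknD_sub_ballMean`; then `scaledEnergies_bounded_of_weakL3_slices` with `E(z,R/2) ≤ 2N`,
`D(z,R/2) ≤ 4N`). [cite: Seregin2019, §2 (2.1) and §4 (4.5) (arXiv:1906.06707 pp. 5, 7)] -/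
theorem exists_scaledEnergies_bound (M N : ℝ) : ∃ K : ℝ≥0,
    ∀ (z₀ : ℝ × EuclideanSpace ℝ (Fin 3)) (R : ℝ)
      (u : ℝ → EuclideanSpace ℝ (Fin 3) → EuclideanSpace ℝ (Fin 3))
      (p : ℝ → EuclideanSpace ℝ (Fin 3) → ℝ)
      (G : ℝ → EuclideanSpace ℝ (Fin 3) → EuclideanSpace ℝ (Fin 3) →L[ℝ] EuclideanSpace ℝ (Fin 3)),
      0 < R → IsSuitableWeakSolutionInBall R z₀ u p →
      HasWeakSpatialGradientOn (parabolicCylinderOpens R z₀) u G →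
      cknDOsc R z₀ p + cknE R z₀ G ≤ ENNReal.ofReal N →
      (∀ t ∈ Ioo (z₀.1 - R ^ 2) z₀.1, ∀ α : ℝ, 0 < α →
        ENNReal.ofReal (α ^ 3) *
            (volume.restrict (ball z₀.2 R)) {x : EuclideanSpace ℝ (Fin 3) | α < ‖u t x‖} ≤
          ENNReal.ofReal (M ^ 3)) →
      ∀ z : ℝ × EuclideanSpace ℝ (Fin 3), parabolicCylinder (R / 2) z ⊆ parabolicCylinder R z₀ →
        ∀ r ∈ Ioc (0 : ℝ) (R / 4),
          cknAEss r z u ≤ K ∧ cknE r z G ≤ K ∧ cknC r z u ≤ K ∧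
            cknD r z (fun t x => p t x - ⨍ y in ball z₀.2 R, p t y) ≤ K := by
  obtain ⟨K, hK⟩ :=
    scaledEnergies_bounded_of_weakL3_slices M.toNNReal (2 * N.toNNReal) (4 * N.toNNReal)
  refine ⟨K, fun z₀ R u p G hR hsol hG hN hsl z hz r hr => ?_⟩
  have hsolq : IsSuitableWeakSolutionInBall R z₀ u (fun t x => p t x - ⨍ y in ball z₀.2 R, p t y) :=
    isSuitableWeakSolutionInBall_sub_ballMean hR hsol
  have hum := ae_aestronglyMeasurable_ballSlice hsol
  have hsl' : ∀ t ∈ Ioo (z₀.1 - R ^ 2) z₀.1, ∀ α : ℝ, 0 < α →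
      ENNReal.ofReal (α ^ 3) *
          (volume.restrict (ball z₀.2 R)) {x : EuclideanSpace ℝ (Fin 3) | α < ‖u t x‖} ≤
        ENNReal.ofReal (((M.toNNReal : ℝ≥0) : ℝ) ^ 3) :=
    fun t ht α hα => (hsl t ht α hα).trans (ofReal_pow_three_le_toNNReal M)
  have hN' : ENNReal.ofReal N = ((N.toNNReal : ℝ≥0) : ℝ≥0∞) := rfl
  have hDosc : cknDOsc R z₀ p ≤ ((N.toNNReal : ℝ≥0) : ℝ≥0∞) := hN' ▸ le_self_add.trans hN
  have hER : cknE R z₀ G ≤ ((N.toNNReal : ℝ≥0) : ℝ≥0∞) := hN' ▸ le_add_self.trans hN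
  have hR2 : 0 < R / 2 := half_pos hR
  have hRR : R / (R / 2) = 2 := by field_simp
  have hE2 : cknE (R / 2) z G ≤ ((2 * N.toNNReal : ℝ≥0) : ℝ≥0∞) := by
    refine (cknE_le_mul_of_subset hR hR2 hz G).trans ?_
    rw [hRR, ENNReal.ofReal_ofNat, ENNReal.coe_mul, ENNReal.coe_ofNat]
    gcongr
  have hD2 : cknD (R / 2) z (fun t x => p t x - ⨍ y in ball z₀.2 R, p t y) ≤
      ((4 * N.toNNReal : ℝ≥0) : ℝ≥0∞) := by
    refine (cknD_le_mul_of_subset hR hR2 hz _).trans ?_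
    rw [hRR, ENNReal.ofReal_ofNat, cknD_sub_ballMean, ENNReal.coe_mul, ENNReal.coe_ofNat,
      show ((2 : ℝ≥0∞)) ^ 2 = 4 by norm_num]
    gcongr
  have hsum := hK z₀ R u _ G hsolq hG hum hsl' z (R / 2) hR2 hz hE2 hD2 r
    ⟨hr.1, by linarith [hr.2]⟩
  refine ⟨?_, ?_, ?_, ?_⟩
  · exact le_trans (by exact le_add_of_le_of_nonneg (le_add_of_le_of_nonneg le_self_add bot_le) bot_le)
      hsum
  · exact le_trans (le_add_of_le_of_nonneg (le_add_of_le_of_nonneg le_add_self bot_le) bot_le) hsum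
  · exact le_trans (le_add_of_le_of_nonneg le_add_self bot_le) hsum
  · exact le_trans le_add_self hsum

/-! ### The `L³ × L^{3/2}` levels on a parabolic ball in terms of `C` and `D` -/

/-- `‖u‖_{L³(Q(z,r))} = (r² C(z,r))^{1/3}`. [cite: CaffarelliKohnNirenberg1982, §2 (the scaled quantity C)] -/
theorem eLpNorm_three_cylinder_eq {r : ℝ} (hr : 0 < r) (z : ℝ × EuclideanSpace ℝ (Fin 3))
    (u : ℝ → EuclideanSpace ℝ (Fin 3) → EuclideanSpace ℝ (Fin 3)) :
    eLpNorm (uncurry u) 3 (volume.restrict (parabolicCylinder r z)) =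
      (ENNReal.ofReal r ^ 2 * cknC r z u) ^ (1 / 3 : ℝ) := by
  rw [eLpNorm_three_eq_lintegral_cube_rpow, cknC, ← mul_assoc,
    ENNReal.mul_inv_cancel (pow_ne_zero _ (ENNReal.ofReal_pos.2 hr).ne')
      (ENNReal.pow_ne_top ENNReal.ofReal_ne_top), one_mul]
  rfl

/-- `‖p‖_{L^{3/2}(Q(z,r))} = (r² D(z,r))^{2/3}`. [cite: CaffarelliKohnNirenberg1982, §2 (the scaled quantity D)] -/
theorem eLpNorm_threeHalves_cylinder_eq {r : ℝ} (hr : 0 < r) (z : ℝ × EuclideanSpace ℝ (Fin 3))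
    (p : ℝ → EuclideanSpace ℝ (Fin 3) → ℝ) :
    eLpNorm (uncurry p) (3 / 2) (volume.restrict (parabolicCylinder r z)) =
      (ENNReal.ofReal r ^ 2 * cknD r z p) ^ (2 / 3 : ℝ) := by
  have h32 : ((3 : ℝ≥0∞) / 2).toReal = 3 / 2 := by
    rw [ENNReal.toReal_div]; norm_num
  have h32top : (3 : ℝ≥0∞) / 2 ≠ ⊤ := (ENNReal.div_lt_top (by simp) (by simp)).ne
  rw [eLpNorm_eq_lintegral_rpow_enorm_toReal (by norm_num) h32top, h32, cknD, ← mul_assoc,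
    ENNReal.mul_inv_cancel (pow_ne_zero _ (ENNReal.ofReal_pos.2 hr).ne')
      (ENNReal.pow_ne_top ENNReal.ofReal_ne_top), one_mul,
    show (1 / (3 / 2 : ℝ)) = 2 / 3 by norm_num]
  rfl

/-! ### Scaling tools for slices (private copies of the private tools of
`AlbrittonBarker2020LocalConcentrationBlowup.lean`, which are not importable) -/

section SliceTools

/-- Volume of preimages under the space dilation `y ↦ x₀ + γy` of `ℝ³`. [folklore] -/
private theorem volume_preimage_space_dilate' {γ : ℝ} (hγ : 0 < γ)
    (x₀ : EuclideanSpace ℝ (Fin 3)) (B : Set (EuclideanSpace ℝ (Fin 3))) :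
    volume ((fun y : EuclideanSpace ℝ (Fin 3) => x₀ + γ • y) ⁻¹' B) =
      ENNReal.ofReal (γ ^ 3)⁻¹ * volume B := by
  have hme := (spaceAffineHomeomorph hγ.ne' x₀).measurableEmbedding
  have h := hme.map_apply (volume : Measure (EuclideanSpace ℝ (Fin 3))) B
  rw [coe_spaceAffineHomeomorph] at h
  rw [← h, map_space_affine_volume hγ x₀, Measure.smul_apply, smul_eq_mul,
    finrank_euclideanSpace_fin]

/-- Superlevel sets of a dilated slice inside a ball:
`|{y ∈ B(0,ρ) : a < ‖α f(x₀ + γy)‖}| = γ⁻³ |{x ∈ B(x₀, γρ) : a/α < ‖f x‖}|`. [folklore] -/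
private theorem restrict_ball_superlevel_space_dilate' {α γ : ℝ} (hα : 0 < α) (hγ : 0 < γ)
    (x₀ : EuclideanSpace ℝ (Fin 3)) (f : EuclideanSpace ℝ (Fin 3) → EuclideanSpace ℝ (Fin 3))
    (a ρ : ℝ) :
    (volume.restrict (ball (0 : EuclideanSpace ℝ (Fin 3)) ρ))
        {y : EuclideanSpace ℝ (Fin 3) | a < ‖α • f (x₀ + γ • y)‖} =
      ENNReal.ofReal (γ ^ 3)⁻¹ *
        (volume.restrict (ball x₀ (γ * ρ))) {x : EuclideanSpace ℝ (Fin 3) | a / α < ‖f x‖} := by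
  rw [Measure.restrict_apply' measurableSet_ball, Measure.restrict_apply' measurableSet_ball]
  have hset : {y : EuclideanSpace ℝ (Fin 3) | a < ‖α • f (x₀ + γ • y)‖} ∩ ball 0 ρ =
      (fun y : EuclideanSpace ℝ (Fin 3) => x₀ + γ • y) ⁻¹'
        ({x : EuclideanSpace ℝ (Fin 3) | a / α < ‖f x‖} ∩ ball x₀ (γ * ρ)) := by
    ext y
    constructor
    · rintro ⟨h1, h2⟩
      refine ⟨?_, ?_⟩
      · rw [mem_setOf_eq, norm_smul, Real.norm_eq_abs, abs_of_pos hα] at h1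
        rw [mem_setOf_eq, div_lt_iff₀' hα]
        exact h1
      · rw [mem_ball_zero_iff] at h2
        rw [mem_ball, dist_eq_norm, add_sub_cancel_left, norm_smul, Real.norm_eq_abs, abs_of_pos hγ]
        exact mul_lt_mul_of_pos_left h2 hγ
    · rintro ⟨h1, h2⟩
      refine ⟨?_, ?_⟩
      · rw [mem_setOf_eq, div_lt_iff₀' hα] at h1
        rw [mem_setOf_eq, norm_smul, Real.norm_eq_abs, abs_of_pos hα]
        exact h1
      · rw [mem_ball, dist_eq_norm, add_sub_cancel_left, norm_smul, Real.norm_eq_abs,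
          abs_of_pos hγ] at h2
        rw [mem_ball_zero_iff]
        exact lt_of_mul_lt_mul_left h2 hγ.le
  rw [hset, volume_preimage_space_dilate' hγ]

/-- Pairings of a dilated slice against a test field:
`∫ ⟪α f(x₀ + γy), φ(y)⟫ dy = α γ⁻³ ∫ ⟪f x, φ(γ⁻¹(x − x₀))⟫ dx`. [folklore] -/
private theorem integral_inner_space_dilate' {γ : ℝ} (hγ : 0 < γ) (α : ℝ)
    (x₀ : EuclideanSpace ℝ (Fin 3)) (f φ : EuclideanSpace ℝ (Fin 3) → EuclideanSpace ℝ (Fin 3)) :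
    ∫ y, ⟪α • f (x₀ + γ • y), φ y⟫ =
      α * (γ ^ 3)⁻¹ * ∫ x, ⟪f x, φ (γ⁻¹ • (x - x₀))⟫ := by
  have h1 : ∀ y : EuclideanSpace ℝ (Fin 3), ⟪α • f (x₀ + γ • y), φ y⟫ =
      α * ⟪f (x₀ + γ • y), φ (γ⁻¹ • ((x₀ + γ • y) - x₀))⟫ := by
    intro y
    rw [real_inner_smul_left, add_sub_cancel_left, smul_smul, inv_mul_cancel₀ hγ.ne', one_smul]
  simp_rw [h1]
  rw [integral_const_mul, integral_comp_space_affine hγ x₀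
    (fun x => ⟪f x, φ (γ⁻¹ • (x - x₀))⟫), finrank_euclideanSpace_fin, smul_eq_mul, mul_assoc]

/-- `φ(γ⁻¹(· − x₀)) ∈ L²` for `φ ∈ L²`, `γ > 0`. [folklore] -/
private theorem memLp_two_comp_space_dilate_symm' {γ : ℝ} (hγ : 0 < γ) (x₀ : EuclideanSpace ℝ (Fin 3))
    {φ : EuclideanSpace ℝ (Fin 3) → EuclideanSpace ℝ (Fin 3)} (hφ : MemLp φ 2 volume) :
    MemLp (fun x => φ (γ⁻¹ • (x - x₀))) 2 volume := by
  have e : (fun x : EuclideanSpace ℝ (Fin 3) => γ⁻¹ • (x - x₀)) =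
      fun x => (-(γ⁻¹ • x₀)) + γ⁻¹ • x := by
    funext x
    rw [smul_sub]
    abel
  have hmap : Measure.map (fun x : EuclideanSpace ℝ (Fin 3) => γ⁻¹ • (x - x₀)) volume =
      ENNReal.ofReal ((γ⁻¹) ^ Module.finrank ℝ (EuclideanSpace ℝ (Fin 3)))⁻¹ • volume := by
    rw [e]
    exact map_space_affine_volume (inv_pos.2 hγ) _
  have h2 : MemLp φ 2 (Measure.map (fun x : EuclideanSpace ℝ (Fin 3) => γ⁻¹ • (x - x₀)) volume) := by
    rw [hmap]
    exact hφ.smul_measure ENNReal.ofReal_ne_top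
  have hmeas : AEMeasurable (fun x : EuclideanSpace ℝ (Fin 3) => γ⁻¹ • (x - x₀)) volume :=
    ((measurable_id.sub_const x₀).const_smul γ⁻¹).aemeasurable
  exact h2.comp_of_map hmeas

end SliceTools

/-! ### The rescaled violator `U(s,y) = λ u(t₀ + λ²s, x₀ + λy)`, `P(s,y) = λ² p̃(t₀ + λ²s, x₀ + λy)` -/

section Zoom

variable {z₀ : ℝ × EuclideanSpace ℝ (Fin 3)} {R lam : ℝ}
  {u : ℝ → EuclideanSpace ℝ (Fin 3) → EuclideanSpace ℝ (Fin 3)}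
  {p : ℝ → EuclideanSpace ℝ (Fin 3) → ℝ}

/-- The zoom fixes the apex: `Φ_λ(0) = z₀`. [folklore] -/
private theorem stAffine_zero_apex (lam : ℝ) (z₀ : ℝ × EuclideanSpace ℝ (Fin 3)) :
    stAffine (lam ^ 2) lam z₀.1 z₀.2 (0 : ℝ × EuclideanSpace ℝ (Fin 3)) = z₀ :=
  Prod.ext (by rw [stAffine_fst]; simp) (by rw [stAffine_snd]; simp)

/-- **Scaled energies of the rescaled pair at shifted apices** (NS scaling, CKN 1982 §2; in
print (4.5) for `u^k`): `C(z, ϱ)[λu(t₀+λ²·, x₀+λ·)] = C(Φ_λ z, λϱ)[u]` and the same for `D` with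
the weight `λ²`, together with: if `z.1 ≤ 0`, `λ²|z.1| ≤ 3R²/4` and `λ|z.2| ≤ R/2` then
`Q(Φ_λ z, R/2) ⊆ Q(z₀, R)` (a good apex). [cite: CaffarelliKohnNirenberg1982, §2 (scaling of C, D)] -/
theorem zoom_apex_subset (hlam : 0 < lam) {z : ℝ × EuclideanSpace ℝ (Fin 3)} (hz : z.1 ≤ 0)
    (h1 : lam ^ 2 * |z.1| ≤ 3 * R ^ 2 / 4) (h2 : lam * ‖z.2‖ ≤ R / 2) :
    parabolicCylinder (R / 2) (stAffine (lam ^ 2) lam z₀.1 z₀.2 z) ⊆ parabolicCylinder R z₀ := by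
  rw [parabolicCylinder, parabolicCylinder, stAffine_fst, stAffine_snd]
  rw [abs_of_nonpos hz] at h1
  refine prod_mono (Ioo_subset_Ioo (by nlinarith) (by nlinarith [pow_pos hlam 2])) ?_
  refine ball_subset_ball' ?_
  rw [dist_eq_norm, add_sub_cancel_left, norm_smul, Real.norm_eq_abs, abs_of_pos hlam]
  linarith

/-- `C(z, ϱ)[U] = C(Φ_λ z, λϱ)[u]`, `C(0, ϱ)[U] = C(z₀, λϱ)[u]`. [cite: CaffarelliKohnNirenberg1982, §2 (scaling of C)] -/
theorem cknC_zoom (hlam : 0 < lam) {ϱ : ℝ} (hϱ : 0 < ϱ) (z : ℝ × EuclideanSpace ℝ (Fin 3))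
    (u : ℝ → EuclideanSpace ℝ (Fin 3) → EuclideanSpace ℝ (Fin 3)) :
    cknC ϱ z (lam • stPull (lam ^ 2) lam z₀.1 z₀.2 u) =
      cknC (lam * ϱ) (stAffine (lam ^ 2) lam z₀.1 z₀.2 z) u :=
  cknC_nsZoom hlam hϱ z₀.1 z₀.2 z u

/-- `D(z, ϱ)[P] = D(Φ_λ z, λϱ)[p̃]`. [cite: CaffarelliKohnNirenberg1982, §2 (scaling of D)] -/
theorem cknD_zoom (hlam : 0 < lam) {ϱ : ℝ} (hϱ : 0 < ϱ) (z : ℝ × EuclideanSpace ℝ (Fin 3))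
    (q : ℝ → EuclideanSpace ℝ (Fin 3) → ℝ) :
    cknD ϱ z (lam ^ 2 • stPull (lam ^ 2) lam z₀.1 z₀.2 q) =
      cknD (lam * ϱ) (stAffine (lam ^ 2) lam z₀.1 z₀.2 z) q :=
  cknD_nsZoom hlam hϱ z₀.1 z₀.2 z q

/-- `C(0, ϱ)[U] = C(z₀, λϱ)[u]`. [cite: CaffarelliKohnNirenberg1982, §2 (scaling of C)] -/
theorem cknC_zoom_zero (hlam : 0 < lam) {ϱ : ℝ} (hϱ : 0 < ϱ)
    (u : ℝ → EuclideanSpace ℝ (Fin 3) → EuclideanSpace ℝ (Fin 3)) :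
    cknC ϱ (0 : ℝ × EuclideanSpace ℝ (Fin 3)) (lam • stPull (lam ^ 2) lam z₀.1 z₀.2 u) =
      cknC (lam * ϱ) z₀ u := by
  rw [cknC_zoom hlam hϱ, stAffine_zero_apex]

/-- `D(0, ϱ)[P] = D(z₀, λϱ)[p̃]`. [cite: CaffarelliKohnNirenberg1982, §2 (scaling of D)] -/
theorem cknD_zoom_zero (hlam : 0 < lam) {ϱ : ℝ} (hϱ : 0 < ϱ)
    (q : ℝ → EuclideanSpace ℝ (Fin 3) → ℝ) :
    cknD ϱ (0 : ℝ × EuclideanSpace ℝ (Fin 3)) (lam ^ 2 • stPull (lam ^ 2) lam z₀.1 z₀.2 q) =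
      cknD (lam * ϱ) z₀ q := by
  rw [cknD_zoom hlam hϱ, stAffine_zero_apex]

/-- **Levels of the rescaled pair** (print: (4.5) ⇒ `u^k, p^k` bounded in `L³ × L^{3/2}(Q(a))`):
if `C(z₀, r), D(z₀, r)[p̃] ≤ K` for `0 < r ≤ R/4` and `λ a ≤ R/4`, then
`‖U‖_{L³(Q(a))} + ‖P‖_{L^{3/2}(Q(a))} ≤ (a²K)^{1/3} + (a²K)^{2/3}`.
[cite: Seregin2019, §4 (4.5) (arXiv:1906.06707 p. 7)] -/
theorem eLpNorm_zoom_levels_le (hlam : 0 < lam) {K : ℝ≥0}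
    {q : ℝ → EuclideanSpace ℝ (Fin 3) → ℝ}
    (hC : ∀ r ∈ Ioc (0 : ℝ) (R / 4), cknC r z₀ u ≤ K)
    (hD : ∀ r ∈ Ioc (0 : ℝ) (R / 4), cknD r z₀ q ≤ K) {a : ℝ} (ha : 0 < a)
    (haR : lam * a ≤ R / 4) :
    eLpNorm (uncurry (lam • stPull (lam ^ 2) lam z₀.1 z₀.2 u)) 3
        (volume.restrict (parabolicCylinder a (0 : ℝ × EuclideanSpace ℝ (Fin 3)))) +
      eLpNorm (uncurry (lam ^ 2 • stPull (lam ^ 2) lam z₀.1 z₀.2 q)) (3 / 2)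
        (volume.restrict (parabolicCylinder a (0 : ℝ × EuclideanSpace ℝ (Fin 3)))) ≤
      (ENNReal.ofReal a ^ 2 * K) ^ (1 / 3 : ℝ) + (ENNReal.ofReal a ^ 2 * K) ^ (2 / 3 : ℝ) := by
  have hmem : lam * a ∈ Ioc (0 : ℝ) (R / 4) := ⟨by positivity, haR⟩
  rw [eLpNorm_three_cylinder_eq ha, eLpNorm_threeHalves_cylinder_eq ha, cknC_zoom_zero hlam ha,
    cknD_zoom_zero hlam ha]
  gcongr
  · exact hC _ hmem
  · exact hD _ hmem

/-- **Superlevel sets of the rescaled slices**: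
`|{y ∈ B(0,a) : t < |U(s,y)|}| = λ⁻³ |{x ∈ B(x₀,λa) : t/λ < |u(t₀+λ²s, x)|}|`. [folklore] -/
private theorem zoom_restrict_ball_superlevel (hlam : 0 < lam)
    (u : ℝ → EuclideanSpace ℝ (Fin 3) → EuclideanSpace ℝ (Fin 3)) (s a t : ℝ) :
    (volume.restrict (ball (0 : EuclideanSpace ℝ (Fin 3)) a))
        {y | t < ‖(lam • stPull (lam ^ 2) lam z₀.1 z₀.2 u) s y‖} =
      ENNReal.ofReal (lam ^ 3)⁻¹ *
        (volume.restrict (ball z₀.2 (lam * a))) {x | t / lam < ‖u (z₀.1 + lam ^ 2 * s) x‖} :=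
  restrict_ball_superlevel_space_dilate' hlam hlam z₀.2 (u (z₀.1 + lam ^ 2 * s)) t a

/-- **Weak-`L³` slices of the rescaled velocity** (print (4.7) for `u^k`: "`|{… |u^k(y,s)| > N}| ≤
M³/N³` for all `s`"): if `α³|{x ∈ B(x₀,R) : α < |u(t,x)|}| ≤ M³` for `t ∈ ]t₀-R²,t₀[`, `α > 0`, and
`λ a ≤ R`, then `t³|{y ∈ B(0,a) : t < |U(s,y)|}| ≤ M³` for `s ∈ ]-a²,0[`, `t > 0`.
[cite: Seregin2019, §4 (4.7) (arXiv:1906.06707 p. 7)] -/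
theorem zoom_weakL3_slice {M : ℝ} (hlam : 0 < lam) {a : ℝ} (ha : 0 < a) (haR : lam * a ≤ R)
    (hsl : ∀ t ∈ Ioo (z₀.1 - R ^ 2) z₀.1, ∀ α : ℝ, 0 < α →
      ENNReal.ofReal (α ^ 3) *
          (volume.restrict (ball z₀.2 R)) {x : EuclideanSpace ℝ (Fin 3) | α < ‖u t x‖} ≤
        ENNReal.ofReal (M ^ 3))
    {s : ℝ} (hs : s ∈ Ioo (-a ^ 2) (0 : ℝ)) {t : ℝ} (ht : 0 < t) :
    ENNReal.ofReal (t ^ 3) *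
        (volume.restrict (ball (0 : EuclideanSpace ℝ (Fin 3)) a))
          {y | t < ‖(lam • stPull (lam ^ 2) lam z₀.1 z₀.2 u) s y‖} ≤
      ENNReal.ofReal (M ^ 3) := by
  rw [zoom_restrict_ball_superlevel hlam]
  have hla2 : lam ^ 2 * a ^ 2 ≤ R ^ 2 := by
    rw [← mul_pow]; exact pow_le_pow_left₀ (by positivity) haR 2
  have htime : z₀.1 + lam ^ 2 * s ∈ Ioo (z₀.1 - R ^ 2) z₀.1 := by
    refine ⟨?_, ?_⟩
    · nlinarith [hs.1, pow_pos hlam 2]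
    · nlinarith [hs.2, pow_pos hlam 2]
  have hmono : (volume.restrict (ball z₀.2 (lam * a)))
        {x : EuclideanSpace ℝ (Fin 3) | t / lam < ‖u (z₀.1 + lam ^ 2 * s) x‖} ≤
      (volume.restrict (ball z₀.2 R))
        {x : EuclideanSpace ℝ (Fin 3) | t / lam < ‖u (z₀.1 + lam ^ 2 * s) x‖} :=
    Measure.le_iff'.1 (Measure.restrict_mono_set volume (ball_subset_ball haR)) _
  calc ENNReal.ofReal (t ^ 3) * (ENNReal.ofReal (lam ^ 3)⁻¹ *
        (volume.restrict (ball z₀.2 (lam * a)))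
          {x : EuclideanSpace ℝ (Fin 3) | t / lam < ‖u (z₀.1 + lam ^ 2 * s) x‖})
      = ENNReal.ofReal ((t / lam) ^ 3) * (volume.restrict (ball z₀.2 (lam * a)))
          {x : EuclideanSpace ℝ (Fin 3) | t / lam < ‖u (z₀.1 + lam ^ 2 * s) x‖} := by
        rw [← mul_assoc, ← ENNReal.ofReal_mul (by positivity), div_pow, div_eq_mul_inv (t ^ 3)]
    _ ≤ ENNReal.ofReal ((t / lam) ^ 3) * (volume.restrict (ball z₀.2 R))
          {x : EuclideanSpace ℝ (Fin 3) | t / lam < ‖u (z₀.1 + lam ^ 2 * s) x‖} := by gcongr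
    _ ≤ ENNReal.ofReal (M ^ 3) := hsl _ htime (t / lam) (by positivity)

/-- **The sparse top slice after rescaling** (print (4.8): "`|{x ∈ B(ε_k^{-1}) : |u^k(x,0)| >
ε_k}| < ε_k`", here with a general scale): if `|{x ∈ B(x₀,r) : ε/r < |u(t₀,x)|}| ≤ ε r³` then
`|{y ∈ B(0, r/λ) : λε/r < |U(0,y)|}| ≤ ε r³/λ³`. [cite: Seregin2019, §4 (4.8) (arXiv:1906.06707 p. 7)] -/
theorem zoom_sparse_top (hlam : 0 < lam) {r ε : ℝ} (hr : 0 < r)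
    (hsp : (volume.restrict (ball z₀.2 r)) {x : EuclideanSpace ℝ (Fin 3) | ε / r < ‖u z₀.1 x‖} ≤
      ENNReal.ofReal (ε * r ^ 3)) :
    (volume.restrict (ball (0 : EuclideanSpace ℝ (Fin 3)) (r / lam)))
        {y | lam * ε / r < ‖(lam • stPull (lam ^ 2) lam z₀.1 z₀.2 u) 0 y‖} ≤
      ENNReal.ofReal (ε * r ^ 3 / lam ^ 3) := by
  rw [zoom_restrict_ball_superlevel hlam]
  have e1 : lam * (r / lam) = r := by field_simp
  have e2 : lam * ε / r / lam = ε / r := by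
    field_simp
  have e3 : z₀.1 + lam ^ 2 * (0 : ℝ) = z₀.1 := by ring
  rw [e1, e2, e3]
  calc ENNReal.ofReal (lam ^ 3)⁻¹ *
        (volume.restrict (ball z₀.2 r)) {x : EuclideanSpace ℝ (Fin 3) | ε / r < ‖u z₀.1 x‖}
      ≤ ENNReal.ofReal (lam ^ 3)⁻¹ * ENNReal.ofReal (ε * r ^ 3) := by gcongr
    _ = ENNReal.ofReal (ε * r ^ 3 / lam ^ 3) := by
        rw [← ENNReal.ofReal_mul (inv_nonneg.2 (by positivity)), inv_mul_eq_div]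

/-- **Weak left-continuity at the top time survives the rescaling** (Def. 1.1 / the class of
Prop. 1.4: `t ↦ ∫ v(x,t)·w(x) dx` continuous on `[t₀-R², t₀]` for `w ∈ L₂(B(x₀,R))`): if the
pairings of `u` with every `w ∈ L²`, `supp w ⊆ B(x₀,R)`, are left-continuous at `t₀`, then the
pairings of `U` with every `w ∈ L²`, `supp w ⊆ B(0,R/λ)`, are left-continuous at `0`
(change of variables `x = x₀ + λy`). [cite: Seregin2019, Prop. 1.4, hypothesis "s ↦ ∫ v(x,t)·w(x) is continuous" (arXiv:1906.06707 p. 3)] -/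
theorem zoom_weakContinuous_top (hlam : 0 < lam)
    (hcont : ∀ w : EuclideanSpace ℝ (Fin 3) → EuclideanSpace ℝ (Fin 3), MemLp w 2 volume →
      support w ⊆ ball z₀.2 R →
      Tendsto (fun t => ∫ x, ⟪u t x, w x⟫) (𝓝[<] z₀.1) (𝓝 (∫ x, ⟪u z₀.1 x, w x⟫))) :
    ∀ w : EuclideanSpace ℝ (Fin 3) → EuclideanSpace ℝ (Fin 3), MemLp w 2 volume →
      support w ⊆ ball (0 : EuclideanSpace ℝ (Fin 3)) (R / lam) →
      Tendsto (fun s => ∫ y, ⟪(lam • stPull (lam ^ 2) lam z₀.1 z₀.2 u) s y, w y⟫) (𝓝[<] 0)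
        (𝓝 (∫ y, ⟪(lam • stPull (lam ^ 2) lam z₀.1 z₀.2 u) 0 y, w y⟫)) := by
  intro w hw hws
  have hw' : MemLp (fun x => w (lam⁻¹ • (x - z₀.2))) 2 volume :=
    memLp_two_comp_space_dilate_symm' hlam z₀.2 hw
  have hws' : support (fun x => w (lam⁻¹ • (x - z₀.2))) ⊆ ball z₀.2 R := by
    intro x hx
    have h1 : lam⁻¹ • (x - z₀.2) ∈ ball (0 : EuclideanSpace ℝ (Fin 3)) (R / lam) := hws hx
    rw [mem_ball_zero_iff, norm_smul, Real.norm_eq_abs, abs_of_pos (inv_pos.2 hlam),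
      inv_mul_eq_div, div_lt_div_iff_of_pos_right hlam] at h1
    rwa [mem_ball, dist_eq_norm]
  have key : ∀ s : ℝ, ∫ y, ⟪(lam • stPull (lam ^ 2) lam z₀.1 z₀.2 u) s y, w y⟫ =
      lam * (lam ^ 3)⁻¹ * ∫ x, ⟪u (z₀.1 + lam ^ 2 * s) x, w (lam⁻¹ • (x - z₀.2))⟫ :=
    fun s => integral_inner_space_dilate' hlam lam z₀.2 (u (z₀.1 + lam ^ 2 * s)) w
  simp_rw [key]
  rw [mul_zero, add_zero]
  refine Tendsto.const_mul _ ?_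
  have hmap : Tendsto (fun s : ℝ => z₀.1 + lam ^ 2 * s) (𝓝[<] 0) (𝓝[<] z₀.1) := by
    refine tendsto_nhdsWithin_of_tendsto_nhds_of_eventually_within _ ?_ ?_
    · have hc : Continuous (fun s : ℝ => z₀.1 + lam ^ 2 * s) := by fun_prop
      have h := hc.tendsto 0
      rw [mul_zero, add_zero] at h
      exact h.mono_left nhdsWithin_le_nhds
    · filter_upwards [self_mem_nhdsWithin] with s hs
      have hs' : s < 0 := hs
      show z₀.1 + lam ^ 2 * s < z₀.1
      nlinarith [pow_pos hlam 2]
  exact (hcont _ hw' hws').comp hmap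

end Zoom

end Seregin2019

end Literature.Analysis.FluidPDE

end
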